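/-
Origin: expansion seat `planner-pub-hodgecm-pohl-g6-0`, handover #1 2026-08-18T06:03:45Z (`HOME/pub-hodgecm-pohl-g6/lean/Pohl6/ToyH0Rank.lean`, md5 bdd53aee, 56 lines);
landed by the gen-6 packager in gate run 24 as `HodgeCM/Model/Toy/H0Rank.lean` (import ^import Pohl6\.→import HodgeCM.Proofs.Pohlmann. ×1).
-/
/-
Copyright: pub-hodgecm formalisation cell (harness21, 2026). New file (not vendored).
Origin: HOME/pub-hodgecm-pohl-g6/lean/Pohl6/ToyH0Rank.lean — session planner-pub-hodgecm-pohl-g6-0 (unit pub-hodgecm-pohl-g6),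
part (b) `PohlmannSpan`, generation 6.  Intended final place: `HodgeCM/Model/Toy/H0Rank.lean` (module `HodgeCM.Model.Toy.H0Rank`;
kind L5) — or appended to `HodgeCM/Model/Toy/DegreeZero.lean` (packager's call).  ADDITIVE.  WIP import `Pohl6.DegreeZeroGeneric` =
the handed-over `HodgeCM/Proofs/Pohlmann/DegreeZeroGeneric.lean` (rewrite to `import HodgeCM.Proofs.Pohlmann.DegreeZeroGeneric`);
`HodgeCM.Model.Toy.DegreeZero` (pohl-g5) is in the run-23 frozen set.
-/
import Summits.HodgeConjecture.HodgeCM.Model.Toy.DegreeZero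
import Summits.HodgeConjecture.HodgeCM.Proofs.Pohlmann.DegreeZeroGeneric

/-!
# `Fact_H0_rank` holds in the toy model; the all-`p` theorem from it is not vacuous

`Proofs/Pohlmann/DegreeZeroGeneric.lean` (pohl-g6) types the degree-`0` input `Fact_H0_rank` (`dim_ℚ H⁰(X, ℚ) = 1` for every
variety of the universe) and proves Gao–Ullmo Thm 3.1 for EVERY `p ≥ 0` from `ModelAxioms` + N1–N4 + `Fact_H0_rank`
(`pohlmannTheorem31All_of_H0_rank`).  In the exterior model `toyModelWith D` (`H^k(X) = ⋀^k_ℚ L_X`) `Fact_H0_rank` is a kernel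
theorem for EVERY Hodge datum `D` (`dim ⋀⁰ L_X = 1`, pohl-g5 `Toy.finrank_coh_zero`), so — unlike F6 `Fact_weightDual` and
`Fact_trTop(CM)`, which fail there (`tr := 0`) — the new input has a non-vacuity witness, and the hypothesis set of
`pohlmannTheorem31All_of_H0_rank` is jointly satisfiable (`pohlmannTheorem31All_of_H0_rank_hypotheses_consistent`).
NOT witnessed here: the generic-facts form `pohlmannTheorem31All_of_genericFacts` (its `Fact_trTopCM` fails in `toyModel`).
-/

noncomputable section

namespace HodgeCM.Toy

variable (D : HodgeData)

/-- **`Fact_H0_rank` in the exterior model** (any Hodge datum), no hypothesis. -/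
theorem fact_H0_rank : (toyModelWith D).Fact_H0_rank := fun X => finrank_coh_zero D X

/-- **`Fact_H0_rank` holds in `toyModel`.** -/
theorem toyModel_fact_H0_rank : toyModel.Fact_H0_rank := fact_H0_rank exteriorHodgeData

/-- `CMProdH0Nontrivial` in the exterior model (any Hodge datum). -/
theorem cmProdH0Nontrivial : (toyModelWith D).CMProdH0Nontrivial :=
  Universe.cmProdH0Nontrivial_of_H0_rank (fact_H0_rank D)

/-- Gao–Ullmo Thm 3.1 (every `p ≥ 0`) in `toyModel` through the `Fact_H0_rank` form (same statement as pohl-g5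
`toyModel_pohlmannTheorem31All`; recorded to exercise `pohlmannTheorem31All_of_H0_rank` on a model). -/
theorem toyModel_pohlmannTheorem31All' : toyModel.PohlmannTheorem31All :=
  Universe.pohlmannTheorem31All_of_H0_rank toyModel_modelAxioms toyModel_fact_cupExterior toyModel_fact_cup_hodge
    toyModel_fact_pull_H0 toyModel_fact_hodge_F0 toyModel_fact_H0_rank

/-- Consistency of the hypothesis set of `Universe.pohlmannTheorem31All_of_H0_rank`
(`ModelAxioms` ∧ N1 ∧ N2 ∧ N3 ∧ N4 ∧ `Fact_H0_rank`). -/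
theorem pohlmannTheorem31All_of_H0_rank_hypotheses_consistent :
    ∃ U : Universe, U.ModelAxioms ∧ U.Fact_cupExterior ∧ U.Fact_cup_hodge ∧ U.Fact_pull_H0 ∧ U.Fact_hodge_F0 ∧
      U.Fact_H0_rank :=
  ⟨toyModel, toyModel_modelAxioms, toyModel_fact_cupExterior, toyModel_fact_cup_hodge, toyModel_fact_pull_H0,
    toyModel_fact_hodge_F0, toyModel_fact_H0_rank⟩

end HodgeCM.Toy

end
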